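import Literature.Barriers.BirchSwinnertonDyer.RankNotSumOfLocalInvariantsK1Dyadic
import Literature.Barriers.BirchSwinnertonDyer.RankNotSumOfLocalInvariantsF4TwistsQ
import Literature.NumberTheory.EllipticCurves.TwoDescentParity
import Literature.NumberTheory.EllipticCurves.TwoDescentRankBounds
import HarnessLib

/-!
# `rk E(F₄)` for `E = 480a1` via `ℚ(√-1)`, VII: the descent engine over `K1 = ℚ(√-1)`

The complete `2`-descent (Silverman AEC Prop. X.1.4, Example X.1.5) over `K1 = ℚ(√-1)` for
the twists `E^{(d)} : y² = x(x + 2d)(x - 3d)` of `480a1` (`Wd d`, the base change to `K1` of the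
tree's `curve480a1.quadraticTwist d`), assembled from files I–VI into one rank-bound machine:

1. a `K1`-point `(x, y)`, `y ≠ 0`, is encoded integrally (`exists_integral_data`:
   `x = z/n`, `y = w/m`, `w² n³ = m² z (z+2dn)(z-3dn)` in `ℤ[i]`), and its descent values
   `b₁ = x`, `b₂ = x + 2d` lie in `K1(S,2)` (`exists_decompositions`, from the tree's parity
   lemma `Valuation.two_dvd_log_map_sub_of_sq_eq` at every prime `p ∤ D` and
   `K1.exists_sq_decomposition` of file II): `b_l = toK1 (i^{a_l} ∏ (gen j)^{e_lj}) t_l²`;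
2. the nine **coordinates** `coord b = (a, e₀, …, e₇)` of such a `b` are themselves values of
   square-class characters (`aBit = qr_{2+i} + ord₃ + ord_{5+4i} + ord_{5-4i} + ord_{8+3i}`,
   and `ord_{gen j}`, mod `2`; `coord_decomposition`), so `P ↦ (coord b₁, coord b₂)` extends
   to a homomorphism `descentCoords : E^{(d)}(K1) →+ (ℤ/2)⁹ × (ℤ/2)⁹` through the tree's
   `twoDescentMap` (`descentCoords_some`); every character is a fixed linear form in the
   coordinates (`MulBit.onK1_eq_coord`, coefficients = the tables of file IV);
3. **the rank bound** (`mordellWeilRank_Wd_add_two_le`): if the coordinates of every point with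
   `y ≠ 0` satisfy a system of linear relations `Rels` whose solutions are separated by `r`
   coordinates (`proj`), and the two `2`-torsion points `(0,0)`, `(-2d,0)` have non-zero,
   distinct `proj`-images with non-zero sum, then `rank E^{(d)}(K1) + 2 ≤ r` — the tree's
   counting lemma `pow_finrank_add_two_le_natCard_range` (`2^{rank+2} ≤ #image`) with the
   Mordell–Weil theorem `module_finite_point_holds`, the kernel of `proj ∘ descentCoords` being
   `2E(K1)` (`ker_twoDescentMap`).

Files VIII–IX feed in the relations proved in files V–VI for `d = 1, 41, 73, 2993`.
Everything is proved; as in `RankNotSumOfLocalInvariantsF4TwistsQ.lean` the point groups carry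
the classical `DecidableEq K1` instance.

## References

* J. H. Silverman, *The Arithmetic of Elliptic Curves*, 2nd ed., GTM 106 (2009), Ch. X §1,
  Prop. X.1.4, Example X.1.5; Thm. VIII.6.7. [SilvermanAEC2009]
* T. Dokchitser, V. Dokchitser, *A note on the Mordell–Weil rank modulo `n`*, J. Number Theory
  131 (2011) 1833–1839, arXiv:0910.4588, proof of Thm. 2. [DokchitserDokchitser2011RankModN]
-/

noncomputable section

attribute [-instance] instDecidableEqQuadraticAlgebra

open scoped Classical

namespace Literature.Barriers.BirchSwinnertonDyer.DokchitserDokchitser2011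

open QuadraticAlgebra WeierstrassCurve WeierstrassCurve.Affine WeierstrassCurve.Affine.Point
  IsDedekindDomain Literature.NumberTheory.EllipticCurves

/-- Mathlib's Gaussian integers `ℤ√-1` (the notation `ℤ[i]` is local to Mathlib's file). -/
local notation "ℤ[i]" => GaussianInt

/-! ### The twists over `K1` -/

/-- **`E^{(d)}` over `K1 = ℚ(√-1)`**: the base change of `curve480a1.quadraticTwist d`.
[folklore] -/
abbrev Wd (d : ℤ) : WeierstrassCurve K1 := (curve480a1.quadraticTwist (d : ℚ)).baseChange K1

/-- `E^{(d)}/K1` is an elliptic curve for `d ≠ 0`. [folklore] -/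
theorem Wd.isElliptic {d : ℤ} (hd : d ≠ 0) : (Wd d).IsElliptic := by
  haveI := isElliptic_twist (d := (d : ℚ)) (by exact_mod_cast hd)
  exact inferInstanceAs ((curve480a1.quadraticTwist (d : ℚ)).map (algebraMap ℚ K1)).IsElliptic

/-- The `a`-invariants of `E^{(d)}/K1`: `(0, -d, 0, -6d², 0)`. [folklore] -/
theorem Wd.a_eq (d : ℤ) : (Wd d).a₁ = 0 ∧ (Wd d).a₂ = -(d : K1) ∧ (Wd d).a₃ = 0 ∧
    (Wd d).a₄ = -6 * (d : K1) ^ 2 ∧ (Wd d).a₆ = 0 := by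
  refine ⟨?_, ?_, ?_, ?_, ?_⟩
  · show algebraMap ℚ K1 (curve480a1.quadraticTwist (d : ℚ)).a₁ = 0
    rw [twist_a₁, _root_.map_zero]
  · show algebraMap ℚ K1 (curve480a1.quadraticTwist (d : ℚ)).a₂ = _
    rw [twist_a₂, map_neg, eq_ratCast, Rat.cast_intCast]
  · show algebraMap ℚ K1 (curve480a1.quadraticTwist (d : ℚ)).a₃ = 0
    rw [twist_a₃, _root_.map_zero]
  · show algebraMap ℚ K1 (curve480a1.quadraticTwist (d : ℚ)).a₄ = _
    rw [twist_a₄, map_mul, map_neg, map_pow, eq_ratCast, eq_ratCast, Rat.cast_intCast]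
    norm_num
  · show algebraMap ℚ K1 (curve480a1.quadraticTwist (d : ℚ)).a₆ = 0
    rw [twist_a₆, _root_.map_zero]

/-- **The equation of `E^{(d)}/K1`**: `y² = x (x + 2d)(x - 3d)`. [folklore] -/
theorem Wd.equation_iff (d : ℤ) (x y : K1) :
    (Wd d).toAffine.Equation x y ↔ y ^ 2 = x * (x + 2 * d) * (x - 3 * d) := by
  obtain ⟨h1, h2, h3, h4, h6⟩ := Wd.a_eq d
  rw [WeierstrassCurve.Affine.equation_iff]
  rw [show (Wd d).toAffine.a₁ = (Wd d).a₁ from rfl, show (Wd d).toAffine.a₂ = (Wd d).a₂ from rfl,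
    show (Wd d).toAffine.a₃ = (Wd d).a₃ from rfl, show (Wd d).toAffine.a₄ = (Wd d).a₄ from rfl,
    show (Wd d).toAffine.a₆ = (Wd d).a₆ from rfl, h1, h2, h3, h4, h6]
  constructor <;> intro h <;> linear_combination h

/-- Nonsingularity on `E^{(d)}/K1`, `d ≠ 0`, is the equation. [folklore] -/
theorem Wd.nonsingular_iff {d : ℤ} (hd : d ≠ 0) (x y : K1) :
    (Wd d).toAffine.Nonsingular x y ↔ y ^ 2 = x * (x + 2 * d) * (x - 3 * d) := by
  haveI := Wd.isElliptic hd
  rw [← WeierstrassCurve.Affine.equation_iff_nonsingular, Wd.equation_iff]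

/-- **`E^{(d)}/K1` has rational `2`-torsion `0, -2d, 3d`.** [folklore] -/
theorem Wd.splitTwoTorsion (d : ℤ) :
    (Wd d).toAffine.SplitTwoTorsion 0 (-2 * (d : K1)) (3 * (d : K1)) := by
  obtain ⟨b2, b4, b6⟩ := splitTwoTorsion_twist (d : ℚ)
  have e2 : (Wd d).toAffine.b₂ = algebraMap ℚ K1 (curve480a1.quadraticTwist (d : ℚ)).b₂ :=
    (curve480a1.quadraticTwist (d : ℚ)).map_b₂ (algebraMap ℚ K1)
  have e4 : (Wd d).toAffine.b₄ = algebraMap ℚ K1 (curve480a1.quadraticTwist (d : ℚ)).b₄ :=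
    (curve480a1.quadraticTwist (d : ℚ)).map_b₄ (algebraMap ℚ K1)
  have e6 : (Wd d).toAffine.b₆ = algebraMap ℚ K1 (curve480a1.quadraticTwist (d : ℚ)).b₆ :=
    (curve480a1.quadraticTwist (d : ℚ)).map_b₆ (algebraMap ℚ K1)
  refine ⟨?_, ?_, ?_⟩
  · rw [e2, show (curve480a1.quadraticTwist (d : ℚ)).b₂ = _ from b2, eq_ratCast]
    push_cast; ring
  · rw [e4, show (curve480a1.quadraticTwist (d : ℚ)).b₄ = _ from b4, eq_ratCast]
    push_cast; ring
  · rw [e6, show (curve480a1.quadraticTwist (d : ℚ)).b₆ = _ from b6, eq_ratCast]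
    push_cast; ring

/-- On `y² = x(x+2d)(x-3d)`, `y = 0` iff `x ∈ {0, -2d, 3d}`; so `y ≠ 0` gives `x ≠ 0, -2d, 3d`.
[folklore] -/
theorem Wd.ne_roots_of_ne_zero {d : ℤ} {x y : K1} (h : y ^ 2 = x * (x + 2 * d) * (x - 3 * d))
    (hy : y ≠ 0) : x ≠ 0 ∧ x ≠ -2 * (d : K1) ∧ x ≠ 3 * (d : K1) := by
  have h0 : x * (x + 2 * d) * (x - 3 * d) ≠ 0 := by rw [← h]; exact pow_ne_zero 2 hy
  simp only [ne_eq, mul_eq_zero, not_or] at h0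
  obtain ⟨⟨h1, h2⟩, h3⟩ := h0
  exact ⟨h1, fun h => h2 (by rw [h]; ring), fun h => h3 (by rw [h]; ring)⟩

/-! ### Integral data of a point -/

/-- **Integral encoding of a `K1`-point**: for `y² = x(x+2d)(x-3d)` with `y ≠ 0` there are
Gaussian integers `z, n, w, m` (`n, m, w ≠ 0`) with `x = z/n`, `x + 2d = (z + 2dn)/n` and
`w² n³ = m² z (z + 2dn)(z - 3dn)`. [folklore] -/
theorem exists_integral_data {d : ℤ} {x y : K1} (h : y ^ 2 = x * (x + 2 * d) * (x - 3 * d))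
    (hy : y ≠ 0) :
    ∃ z n w m : ℤ[i], n ≠ 0 ∧ m ≠ 0 ∧ w ≠ 0 ∧ x = toK1 z / toK1 n ∧
      x + 2 * d = toK1 (z + 2 * d * n) / toK1 n ∧
      w ^ 2 * n ^ 3 = m ^ 2 * (z * (z + 2 * d * n) * (z - 3 * d * n)) := by
  obtain ⟨z, N, hN, hx⟩ := K1.exists_eq_toK1_div_nat x
  obtain ⟨w, M, hM, hyw⟩ := K1.exists_eq_toK1_div_nat y
  have hN0 : (N : ℤ[i]) ≠ 0 := by exact_mod_cast hN.ne'
  have hM0 : (M : ℤ[i]) ≠ 0 := by exact_mod_cast hM.ne'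
  have hNK : (N : K1) ≠ 0 := by exact_mod_cast hN.ne'
  have hMK : (M : K1) ≠ 0 := by exact_mod_cast hM.ne'
  have hw : w ≠ 0 := by
    rintro rfl; rw [_root_.map_zero, zero_div] at hyw; exact hy hyw
  refine ⟨z, N, w, M, hN0, hM0, hw, by rw [toK1_natCast]; exact hx, ?_, ?_⟩
  · rw [toK1_natCast, map_add, map_mul, map_mul, toK1_natCast, hx, map_ofNat, toK1_intCast]
    field_simp
  · apply toK1_injective
    have key : (toK1 w) ^ 2 * (N : K1) ^ 3 =
        (M : K1) ^ 2 * (toK1 z * (toK1 z + 2 * d * N) * (toK1 z - 3 * d * N)) := by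
      rw [hx, hyw] at h
      field_simp at h
      linear_combination h
    simp only [map_mul, map_pow, map_add, map_sub, toK1_natCast, toK1_intCast, map_ofNat]
    exact key

/-! ### The parity of the valuations outside `D` -/

/-- **`ord_p(b₁)` and `ord_p(b₂)` are even at a prime `p ∤ 2d, 3d, 5d`** (Silverman AEC
Thm. X.1.1(c) via the tree's parity lemma `Valuation.two_dvd_log_map_sub_of_sq_eq` at the
`(p)`-adic valuation of `K1`; for `b₁ = x` only `p ∤ 2d, 3d` is used, for `b₂ = x + 2d` only
`p ∤ 2d, 5d`). [cite: SilvermanAEC2009, Thm. X.1.1(c)] -/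
theorem two_dvd_log_valuation_b {d : ℤ} {x y : K1} (h : y ^ 2 = x * (x + 2 * d) * (x - 3 * d))
    (hy : y ≠ 0) (p : ℤ[i]) (hp : Prime p) (hp2 : ¬ p ∣ 2 * (d : ℤ[i])) :
    (¬ p ∣ 3 * (d : ℤ[i]) → (2 : ℤ) ∣ WithZero.log ((primeSpec p hp).valuation K1 x)) ∧
    (¬ p ∣ 5 * (d : ℤ[i]) → (2 : ℤ) ∣ WithZero.log ((primeSpec p hp).valuation K1 (x + 2 * d))) := by
  obtain ⟨hx0, hx2, hx3⟩ := Wd.ne_roots_of_ne_zero h hy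
  set v := (primeSpec p hp).valuation K1 with hv
  have hdK : ((d : ℤ) : K1) = toK1 (d : ℤ[i]) := (toK1_intCast d).symm
  have hint : ∀ c : ℤ[i], v (toK1 c) ≤ 1 := fun c => valuation_toK1_le_one hp c
  have hunit : ∀ c : ℤ[i], ¬ p ∣ c → v (toK1 c) = 1 := fun c hc =>
    (valuation_toK1_eq_one_iff hp).mpr hc
  have he1 : v (0 : K1) ≤ 1 := by rw [_root_.map_zero]; exact zero_le_one
  have he2 : v (-2 * (d : K1)) ≤ 1 := by
    rw [hdK, show (-2 : K1) * toK1 d = toK1 (-2 * d) by rw [map_mul, map_neg, map_ofNat]]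
    exact hint _
  have he3 : v (3 * (d : K1)) ≤ 1 := by
    rw [hdK, show (3 : K1) * toK1 d = toK1 (3 * d) by rw [map_mul, map_ofNat]]
    exact hint _
  have h12 : v ((0 : K1) - -2 * (d : K1)) = 1 := by
    rw [hdK, show (0 : K1) - -2 * toK1 d = toK1 (2 * d) by
      rw [map_mul, map_ofNat]; ring]
    exact hunit _ hp2
  have h21 : v (-2 * (d : K1) - 0) = 1 := by
    rw [hdK, show -2 * toK1 d - (0 : K1) = -toK1 (2 * d) by rw [map_mul, map_ofNat]; ring,
      Valuation.map_neg]
    exact hunit _ hp2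
  refine ⟨fun hp3 => ?_, fun hp5 => ?_⟩
  · have h13 : v ((0 : K1) - 3 * (d : K1)) = 1 := by
      rw [hdK, show (0 : K1) - 3 * toK1 d = -toK1 (3 * d) by rw [map_mul, map_ofNat]; ring,
        Valuation.map_neg]
      exact hunit _ hp3
    have hy1 : y ^ 2 = (x - 0) * (x - -2 * (d : K1)) * (x - 3 * (d : K1)) := by rw [h]; ring
    have := v.two_dvd_log_map_sub_of_sq_eq he1 he2 he3 h12 h13 hx0 hy1
    rwa [sub_zero] at this
  · have h23 : v (-2 * (d : K1) - 3 * (d : K1)) = 1 := by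
      rw [hdK, show -2 * toK1 d - 3 * toK1 d = -toK1 (5 * d) by rw [map_mul, map_ofNat]; ring,
        Valuation.map_neg]
      exact hunit _ hp5
    have hy2 : y ^ 2 = (x - -2 * (d : K1)) * (x - 0) * (x - 3 * (d : K1)) := by rw [h]; ring
    have := v.two_dvd_log_map_sub_of_sq_eq he2 he1 he3 h21 h23 hx2 hy2
    rwa [show x - -2 * (d : K1) = x + 2 * d by ring] at this

/-- **`ord_p(b₁)`, `ord_p(b₂)` are even for `p ∤ D`**, provided `2d, 3d, 5d ∣ D`.
[cite: SilvermanAEC2009, Thm. X.1.1(c)] -/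
theorem two_dvd_log_valuation_of_point {d : ℤ} (hd2 : (2 * (d : ℤ[i])) ∣ D)
    (hd3 : (3 * (d : ℤ[i])) ∣ D) (hd5 : (5 * (d : ℤ[i])) ∣ D) {x y : K1}
    (h : y ^ 2 = x * (x + 2 * d) * (x - 3 * d)) (hy : y ≠ 0) (p : ℤ[i]) (hp : Prime p)
    (hpD : ¬ p ∣ D) :
    (2 : ℤ) ∣ WithZero.log ((primeSpec p hp).valuation K1 x) ∧
      (2 : ℤ) ∣ WithZero.log ((primeSpec p hp).valuation K1 (x + 2 * d)) := by
  have hb := two_dvd_log_valuation_b h hy p hp fun h2 => hpD (h2.trans hd2)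
  exact ⟨hb.1 fun h3 => hpD (h3.trans hd3), hb.2 fun h5 => hpD (h5.trans hd5)⟩

/-- **The valuation-parity coordinate of `b₁` at a good generator vanishes**:
`ord_{gen k}(x) ≡ 0` when `gen k ∤ 2d, 3d`. [cite: SilvermanAEC2009, Thm. X.1.1(c)] -/
theorem ofPrime_onK1_b₁_eq_zero {d : ℤ} {x y : K1} (h : y ^ 2 = x * (x + 2 * d) * (x - 3 * d))
    (hy : y ≠ 0) (k : Fin 8) (hk2 : ¬ gen k ∣ 2 * (d : ℤ[i])) (hk3 : ¬ gen k ∣ 3 * (d : ℤ[i])) :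
    (MulBit.ofPrime (gen k) (prime_gen k)).onK1 x = 0 :=
  (MulBit.ofPrime_onK1_eq_zero_iff (prime_gen k) (Wd.ne_roots_of_ne_zero h hy).1).mpr
    ((two_dvd_log_valuation_b h hy (gen k) (prime_gen k) hk2).1 hk3)

/-- **The valuation-parity coordinate of `b₂` at a good generator vanishes**:
`ord_{gen k}(x + 2d) ≡ 0` when `gen k ∤ 2d, 5d`. [cite: SilvermanAEC2009, Thm. X.1.1(c)] -/
theorem ofPrime_onK1_b₂_eq_zero {d : ℤ} {x y : K1} (h : y ^ 2 = x * (x + 2 * d) * (x - 3 * d))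
    (hy : y ≠ 0) (k : Fin 8) (hk2 : ¬ gen k ∣ 2 * (d : ℤ[i])) (hk5 : ¬ gen k ∣ 5 * (d : ℤ[i])) :
    (MulBit.ofPrime (gen k) (prime_gen k)).onK1 (x + 2 * d) = 0 := by
  have hx2 : x + 2 * d ≠ 0 := fun h0 => (Wd.ne_roots_of_ne_zero h hy).2.1 (by linear_combination h0)
  exact (MulBit.ofPrime_onK1_eq_zero_iff (prime_gen k) hx2).mpr
    ((two_dvd_log_valuation_b h hy (gen k) (prime_gen k) hk2).2 hk5)

/-- **The descent values lie in `K1(S,2)`**: for a point with `y ≠ 0`, both `b₁ = x` and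
`b₂ = x + 2d` are `toK1 (i^a ∏ (gen j)^(e j)) t²`. [cite: SilvermanAEC2009, Prop. X.1.4] -/
theorem exists_decompositions {d : ℤ} (hd2 : (2 * (d : ℤ[i])) ∣ D) (hd3 : (3 * (d : ℤ[i])) ∣ D)
    (hd5 : (5 * (d : ℤ[i])) ∣ D) {x y : K1} (h : y ^ 2 = x * (x + 2 * d) * (x - 3 * d))
    (hy : y ≠ 0) :
    (∃ (a : ℕ) (e : Fin 8 → ℕ) (t : K1), t ≠ 0 ∧ a < 2 ∧ (∀ j, e j < 2) ∧
      x = toK1 (gI ^ a * genProd e) * t ^ 2) ∧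
    (∃ (a : ℕ) (e : Fin 8 → ℕ) (t : K1), t ≠ 0 ∧ a < 2 ∧ (∀ j, e j < 2) ∧
      x + 2 * d = toK1 (gI ^ a * genProd e) * t ^ 2) := by
  obtain ⟨hx0, hx2, -⟩ := Wd.ne_roots_of_ne_zero h hy
  have hx2' : x + 2 * d ≠ 0 := fun h0 => hx2 (by linear_combination h0)
  exact ⟨K1.exists_sq_decomposition hx0 fun p hp hpD =>
      (two_dvd_log_valuation_of_point hd2 hd3 hd5 h hy p hp hpD).1,
    K1.exists_sq_decomposition hx2' fun p hp hpD =>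
      (two_dvd_log_valuation_of_point hd2 hd3 hd5 h hy p hp hpD).2⟩

/-! ### Coordinates -/

namespace MulBit

/-- The sum of two `MulBit`s. [folklore] -/
def add (χ ψ : MulBit) : MulBit where
  toFun z := χ z + ψ z
  map_mul' hz hw := by
    show χ _ + ψ _ = (χ _ + ψ _) + (χ _ + ψ _)
    rw [χ.map_mul hz hw, ψ.map_mul hz hw]; ring

/-- Value of a sum. [folklore] -/
@[simp] theorem add_apply (χ ψ : MulBit) (z : ℤ[i]) : (χ.add ψ) z = χ z + ψ z := rfl

/-- `onK1` of a sum. [folklore] -/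
theorem add_onK1 (χ ψ : MulBit) (x : K1) : (χ.add ψ).onK1 x = χ.onK1 x + ψ.onK1 x := by
  unfold onK1; simp only [add_apply]; ring

end MulBit

/-- **The character reading off the exponent of `i`**:
`aBit = qr_{2+i} + ord₃ + ord_{5+4i} + ord_{5-4i} + ord_{8+3i}` (mod `2`) — by the tables of
file IV it is `1` on `i` and `0` on every `gen j`. [folklore] -/
def aBit : MulBit :=
  (((MulBit.qr5a.add (MulBit.ofPrime (gen 1) (prime_gen 1))).add
    (MulBit.ofPrime (gen 4) (prime_gen 4))).add (MulBit.ofPrime (gen 5) (prime_gen 5))).add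
    (MulBit.ofPrime (gen 6) (prime_gen 6))

/-- `aBit i = 1`. [folklore] -/
theorem aBit_gI : aBit gI = 1 := by
  simp only [aBit, MulBit.add_apply, qr5a_table.1, ofPrime_gen_gI]; decide

/-- `aBit (gen j) = 0`. [folklore] -/
theorem aBit_gen (j : Fin 8) : aBit (gen j) = 0 := by
  simp only [aBit, MulBit.add_apply, qr5a_table.2 j, ofPrime_gen_gen]
  fin_cases j <;> decide

/-- **The nine coordinates of `b ∈ K1`**: `(aBit b, ord_{gen 0} b, …, ord_{gen 7} b) (mod 2)`.
[folklore] -/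
def coord (b : K1) : Fin 9 → ZMod 2 :=
  Fin.cases (aBit.onK1 b) (fun k => (MulBit.ofPrime (gen k) (prime_gen k)).onK1 b)

/-- `coord b 0 = aBit b`. [folklore] -/
theorem coord_zero (b : K1) : coord b 0 = aBit.onK1 b := rfl

/-- `coord b (k+1) = ord_{gen k} b`. [folklore] -/
theorem coord_succ (b : K1) (k : Fin 8) :
    coord b k.succ = (MulBit.ofPrime (gen k) (prime_gen k)).onK1 b := rfl

/-- **The coordinates of a decomposition** `b = toK1 (i^a ∏ (gen j)^(e j)) t²` are `(a, e)`.
[folklore] -/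
theorem coord_decomposition (a : ℕ) (e : Fin 8 → ℕ) {t : K1} (ht : t ≠ 0) :
    coord (toK1 (gI ^ a * genProd e) * t ^ 2) = Fin.cases (a : ZMod 2) (fun k => (e k : ZMod 2)) := by
  funext j
  refine Fin.cases ?_ (fun k => ?_) j
  · rw [coord_zero, aBit.onK1_decomposition a e ht, aBit_gI, mul_one]
    simp only [aBit_gen, mul_zero, Finset.sum_const_zero, add_zero]
    rfl
  · rw [coord_succ, (MulBit.ofPrime (gen k) (prime_gen k)).onK1_decomposition a e ht,
      ofPrime_gen_gI, mul_zero, zero_add]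
    simp only [ofPrime_gen_gen]
    rw [Finset.sum_eq_single k (fun j _ hj => by rw [if_neg hj, mul_zero])
      (fun hk => absurd (Finset.mem_univ k) hk), if_pos rfl, mul_one]
    rfl

/-- **The linear form of a character in coordinates**: `lin χ c = c₀ χ(i) + Σ_k c_{k+1} χ(gen k)`.
[folklore] -/
def lin (χ : MulBit) (c : Fin 9 → ZMod 2) : ZMod 2 :=
  c 0 * χ gI + ∑ k : Fin 8, c k.succ * χ (gen k)

/-- **Every character is a linear form in the coordinates**: for `b = toK1 (i^a ∏ (gen j)^(e j)) t²`
and any `MulBit χ`, `χ(b) = lin χ (coord b) = coord b 0 · χ(i) + Σ_k coord b (k+1) · χ(gen k)`.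
[folklore] -/
theorem MulBit.onK1_eq_coord (χ : MulBit) {b : K1} (a : ℕ) (e : Fin 8 → ℕ) {t : K1} (ht : t ≠ 0)
    (hb : b = toK1 (gI ^ a * genProd e) * t ^ 2) :
    χ.onK1 b = lin χ (coord b) := by
  rw [hb, coord_decomposition a e ht, χ.onK1_decomposition a e ht]
  rfl

/-- The pair of coordinate vectors of `(b₁, b₂)`. [folklore] -/
def coordPair (b₁ b₂ : K1) : (Fin 9 → ZMod 2) × (Fin 9 → ZMod 2) := (coord b₁, coord b₂)

/-! ### The coordinate homomorphism on points -/

/-- The nine coordinate characters as one homomorphism `K1ˣ/K1ˣ² → (ℤ/2)⁹`. [folklore] -/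
def coordHom : Additive (SqUnits K1) →+ (Fin 9 → ZMod 2) :=
  AddMonoidHom.pi (Fin.cases aBit.hom (fun k => (MulBit.ofPrime (gen k) (prime_gen k)).hom))

/-- `coordHom` on a square class is `coord`. [folklore] -/
theorem coordHom_sqClass {b : K1} (hb : b ≠ 0) : coordHom (Additive.ofMul (sqClass b)) = coord b := by
  funext j
  refine Fin.cases ?_ (fun k => ?_) j
  · show aBit.hom (Additive.ofMul (sqClass b)) = coord b 0
    rw [aBit.hom_sqClass hb, coord_zero]
  · show (MulBit.ofPrime (gen k) (prime_gen k)).hom (Additive.ofMul (sqClass b)) = coord b k.succ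
    rw [(MulBit.ofPrime (gen k) (prime_gen k)).hom_sqClass hb, coord_succ]

/-- First projection `Additive (A × B) →+ Additive A`. [folklore] -/
def fstA : Additive (SqUnits K1 × SqUnits K1) →+ Additive (SqUnits K1) :=
  MonoidHom.toAdditive (MonoidHom.fst _ _)

/-- Second projection `Additive (A × B) →+ Additive B`. [folklore] -/
def sndA : Additive (SqUnits K1 × SqUnits K1) →+ Additive (SqUnits K1) :=
  MonoidHom.toAdditive (MonoidHom.snd _ _)

/-- **The descent coordinates of a point**: `P ↦ (coord δ₁(P), coord δ₂(P))`, a homomorphism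
`E^{(d)}(K1) → (ℤ/2)⁹ × (ℤ/2)⁹` (composition of the tree's `twoDescentMap` with `coordHom`).
[cite: SilvermanAEC2009, Prop. X.1.4] -/
def descentCoords (d : ℤ) [(Wd d).IsElliptic] :
    (Wd d).toAffine.Point →+ (Fin 9 → ZMod 2) × (Fin 9 → ZMod 2) :=
  ((coordHom.comp fstA).prod (coordHom.comp sndA)).comp (twoDescentMap (Wd.splitTwoTorsion d))

/-- Unfolding `descentCoords`. [folklore] -/
theorem descentCoords_apply (d : ℤ) [(Wd d).IsElliptic] (P : (Wd d).toAffine.Point) :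
    descentCoords d P =
      (coordHom (Additive.ofMul (twoDescentComponent (Wd d).toAffine 0 (-2 * (d : K1)) (3 * d) P)),
        coordHom (Additive.ofMul
          (twoDescentComponent (Wd d).toAffine (-2 * (d : K1)) 0 (3 * d) P))) := rfl

/-- **The descent coordinates of a point with `y ≠ 0`** are `(coord x, coord (x + 2d))`.
[cite: SilvermanAEC2009, Prop. X.1.4] -/
theorem descentCoords_some {d : ℤ} [(Wd d).IsElliptic] {x y : K1}
    (hP : (Wd d).toAffine.Nonsingular x y) (h : y ^ 2 = x * (x + 2 * d) * (x - 3 * d)) (hy : y ≠ 0) :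
    descentCoords d (Point.some x y hP) = coordPair x (x + 2 * d) := by
  obtain ⟨hx0, hx2, -⟩ := Wd.ne_roots_of_ne_zero h hy
  rw [descentCoords_apply, twoDescentComponent_some_of_ne hP hx0,
    twoDescentComponent_some_of_ne hP hx2, sub_zero,
    show x - -2 * (d : K1) = x + 2 * d by ring, coordHom_sqClass hx0,
    coordHom_sqClass (fun h0 => hx2 (by linear_combination h0))]
  rfl

/-- The descent coordinates of `T₁ = (0, 0)`: `(coord (-6d²), coord (2d))`. [folklore] -/
theorem descentCoords_T₁ {d : ℤ} [(Wd d).IsElliptic] (hd : d ≠ 0)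
    (hT : (Wd d).toAffine.Nonsingular 0 0) :
    descentCoords d (Point.some 0 0 hT) = coordPair (-6 * (d : K1) ^ 2) (2 * d) := by
  have hdK : (d : K1) ≠ 0 := by exact_mod_cast hd
  rw [descentCoords_apply, twoDescentComponent_some_of_eq hT rfl,
    twoDescentComponent_some_of_ne hT (by
      intro h0; apply hdK; linear_combination (1/2 : K1) * h0),
    show ((0 : K1) - -2 * d) * (0 - 3 * d) = -6 * (d : K1) ^ 2 by ring,
    show (0 : K1) - -2 * d = 2 * d by ring,
    coordHom_sqClass (by simpa using hdK), coordHom_sqClass (by simpa using hdK)]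
  rfl

/-- The descent coordinates of `T₂ = (-2d, 0)`: `(coord (-2d), coord (10d²))`. [folklore] -/
theorem descentCoords_T₂ {d : ℤ} [(Wd d).IsElliptic] (hd : d ≠ 0)
    (hT : (Wd d).toAffine.Nonsingular (-2 * (d : K1)) 0) :
    descentCoords d (Point.some (-2 * (d : K1)) 0 hT) = coordPair (-2 * (d : K1)) (10 * d ^ 2) := by
  have hdK : (d : K1) ≠ 0 := by exact_mod_cast hd
  rw [descentCoords_apply, twoDescentComponent_some_of_ne hT (by
      intro h0; apply hdK; linear_combination (-1/2 : K1) * h0),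
    twoDescentComponent_some_of_eq hT rfl,
    show (-2 * (d : K1) - 0) * (-2 * d - 3 * d) = 10 * (d : K1) ^ 2 by ring,
    show -2 * (d : K1) - 0 = -2 * d by ring,
    coordHom_sqClass (by simpa using hdK), coordHom_sqClass (by simpa using hdK)]
  rfl


/-! ### Common bookkeeping for the four descents -/

/-- The valuation-parity character at `gen k`, abbreviated. [folklore] -/
abbrev vP (k : Fin 8) : MulBit := MulBit.ofPrime (gen k) (prime_gen k)

/-- `vP k` under the names of files V–VI. [folklore] -/
theorem vP_eq : vP 0 = MulBit.ofPrime g2 prime_g2 ∧ vP 1 = MulBit.ofPrime 3 prime_three ∧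
    vP 2 = MulBit.ofPrime g5a prime_g5a ∧ vP 3 = MulBit.ofPrime g5b prime_g5b ∧
    vP 4 = MulBit.ofPrime g41a prime_g41a ∧ vP 5 = MulBit.ofPrime g41b prime_g41b ∧
    vP 6 = MulBit.ofPrime g73a prime_g73a ∧ vP 7 = MulBit.ofPrime g73b prime_g73b :=
  ⟨rfl, rfl, rfl, rfl, rfl, rfl, rfl, rfl⟩

/-- The linear form of `ord_{gen k}` in coordinates is the coordinate `k + 1`. [folklore] -/
theorem lin_vP (k : Fin 8) (c : Fin 9 → ZMod 2) : lin (vP k) c = c k.succ := by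
  rw [lin, show (vP k) gI = 0 from ofPrime_gen_gI k, mul_zero, zero_add]
  simp only [show ∀ j, (vP k) (gen j) = if j = k then 1 else 0 from fun j => ofPrime_gen_gen k j]
  rw [Finset.sum_eq_single k (fun j _ hj => by rw [if_neg hj, mul_zero])
    (fun hk => absurd (Finset.mem_univ k) hk), if_pos rfl, mul_one]

/-- `lin (vP 0) c = c 1`. [folklore] -/
theorem lin_vP0 (c : Fin 9 → ZMod 2) : lin (vP 0) c = c 1 := lin_vP 0 c

/-- `lin (vP 1) c = c 2`. [folklore] -/
theorem lin_vP1 (c : Fin 9 → ZMod 2) : lin (vP 1) c = c 2 := lin_vP 1 c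

/-- `lin (vP 2) c = c 3`. [folklore] -/
theorem lin_vP2 (c : Fin 9 → ZMod 2) : lin (vP 2) c = c 3 := lin_vP 2 c

/-- `lin (vP 3) c = c 4`. [folklore] -/
theorem lin_vP3 (c : Fin 9 → ZMod 2) : lin (vP 3) c = c 4 := lin_vP 3 c

/-- `lin (vP 4) c = c 5`. [folklore] -/
theorem lin_vP4 (c : Fin 9 → ZMod 2) : lin (vP 4) c = c 5 := lin_vP 4 c

/-- `lin (vP 5) c = c 6`. [folklore] -/
theorem lin_vP5 (c : Fin 9 → ZMod 2) : lin (vP 5) c = c 6 := lin_vP 5 c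

/-- `lin (vP 6) c = c 7`. [folklore] -/
theorem lin_vP6 (c : Fin 9 → ZMod 2) : lin (vP 6) c = c 7 := lin_vP 6 c

/-- `lin (vP 7) c = c 8`. [folklore] -/
theorem lin_vP7 (c : Fin 9 → ZMod 2) : lin (vP 7) c = c 8 := lin_vP 7 c

/-- The linear form of `qr5a` in coordinates. [folklore] -/
theorem lin_qr5a (c : Fin 9 → ZMod 2) : lin MulBit.qr5a c = c 0 + c 2 + c 5 + c 6 + c 7 := by
  have hI : MulBit.qr5a gI = 1 := qr5a_table.1
  have h0 : MulBit.qr5a (gen 0) = 0 := (qr5a_table.2 0).trans (by decide)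
  have h1 : MulBit.qr5a (gen 1) = 1 := (qr5a_table.2 1).trans (by decide)
  have h2 : MulBit.qr5a (gen 2) = 0 := (qr5a_table.2 2).trans (by decide)
  have h3 : MulBit.qr5a (gen 3) = 0 := (qr5a_table.2 3).trans (by decide)
  have h4 : MulBit.qr5a (gen 4) = 1 := (qr5a_table.2 4).trans (by decide)
  have h5 : MulBit.qr5a (gen 5) = 1 := (qr5a_table.2 5).trans (by decide)
  have h6 : MulBit.qr5a (gen 6) = 1 := (qr5a_table.2 6).trans (by decide)
  have h7 : MulBit.qr5a (gen 7) = 0 := (qr5a_table.2 7).trans (by decide)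
  rw [lin, Fin.sum_univ_eight]
  simp only [Fin.succ_zero_eq_one, Fin.succ_one_eq_two, hI, h0, h1, h2, h3, h4, h5, h6, h7,
    show (2 : Fin 8).succ = 3 from rfl, show (3 : Fin 8).succ = 4 from rfl,
    show (4 : Fin 8).succ = 5 from rfl, show (5 : Fin 8).succ = 6 from rfl,
    show (6 : Fin 8).succ = 7 from rfl, show (7 : Fin 8).succ = 8 from rfl]
  ring

/-- The linear form of `qr5b` in coordinates. [folklore] -/
theorem lin_qr5b (c : Fin 9 → ZMod 2) : lin MulBit.qr5b c = c 0 + c 1 + c 2 + c 5 + c 6 + c 8 := by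
  have hI : MulBit.qr5b gI = 1 := qr5b_table.1
  have h0 : MulBit.qr5b (gen 0) = 1 := (qr5b_table.2 0).trans (by decide)
  have h1 : MulBit.qr5b (gen 1) = 1 := (qr5b_table.2 1).trans (by decide)
  have h2 : MulBit.qr5b (gen 2) = 0 := (qr5b_table.2 2).trans (by decide)
  have h3 : MulBit.qr5b (gen 3) = 0 := (qr5b_table.2 3).trans (by decide)
  have h4 : MulBit.qr5b (gen 4) = 1 := (qr5b_table.2 4).trans (by decide)
  have h5 : MulBit.qr5b (gen 5) = 1 := (qr5b_table.2 5).trans (by decide)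
  have h6 : MulBit.qr5b (gen 6) = 0 := (qr5b_table.2 6).trans (by decide)
  have h7 : MulBit.qr5b (gen 7) = 1 := (qr5b_table.2 7).trans (by decide)
  rw [lin, Fin.sum_univ_eight]
  simp only [Fin.succ_zero_eq_one, Fin.succ_one_eq_two, hI, h0, h1, h2, h3, h4, h5, h6, h7,
    show (2 : Fin 8).succ = 3 from rfl, show (3 : Fin 8).succ = 4 from rfl,
    show (4 : Fin 8).succ = 5 from rfl, show (5 : Fin 8).succ = 6 from rfl,
    show (6 : Fin 8).succ = 7 from rfl, show (7 : Fin 8).succ = 8 from rfl]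
  ring

/-- The linear form of `qr41a` in coordinates. [folklore] -/
theorem lin_qr41a (c : Fin 9 → ZMod 2) : lin MulBit.qr41a c = c 2 + c 3 + c 4 + c 7 + c 8 := by
  have hI : MulBit.qr41a gI = 0 := qr41a_table.1
  have h0 : MulBit.qr41a (gen 0) = 0 := (qr41a_table.2 0).trans (by decide)
  have h1 : MulBit.qr41a (gen 1) = 1 := (qr41a_table.2 1).trans (by decide)
  have h2 : MulBit.qr41a (gen 2) = 1 := (qr41a_table.2 2).trans (by decide)
  have h3 : MulBit.qr41a (gen 3) = 1 := (qr41a_table.2 3).trans (by decide)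
  have h4 : MulBit.qr41a (gen 4) = 0 := (qr41a_table.2 4).trans (by decide)
  have h5 : MulBit.qr41a (gen 5) = 0 := (qr41a_table.2 5).trans (by decide)
  have h6 : MulBit.qr41a (gen 6) = 1 := (qr41a_table.2 6).trans (by decide)
  have h7 : MulBit.qr41a (gen 7) = 1 := (qr41a_table.2 7).trans (by decide)
  rw [lin, Fin.sum_univ_eight]
  simp only [Fin.succ_zero_eq_one, Fin.succ_one_eq_two, hI, h0, h1, h2, h3, h4, h5, h6, h7,
    show (2 : Fin 8).succ = 3 from rfl, show (3 : Fin 8).succ = 4 from rfl,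
    show (4 : Fin 8).succ = 5 from rfl, show (5 : Fin 8).succ = 6 from rfl,
    show (6 : Fin 8).succ = 7 from rfl, show (7 : Fin 8).succ = 8 from rfl]
  ring

/-- The linear form of `qr41b` in coordinates. [folklore] -/
theorem lin_qr41b (c : Fin 9 → ZMod 2) : lin MulBit.qr41b c = c 2 + c 3 + c 4 + c 7 + c 8 := by
  have hI : MulBit.qr41b gI = 0 := qr41b_table.1
  have h0 : MulBit.qr41b (gen 0) = 0 := (qr41b_table.2 0).trans (by decide)
  have h1 : MulBit.qr41b (gen 1) = 1 := (qr41b_table.2 1).trans (by decide)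
  have h2 : MulBit.qr41b (gen 2) = 1 := (qr41b_table.2 2).trans (by decide)
  have h3 : MulBit.qr41b (gen 3) = 1 := (qr41b_table.2 3).trans (by decide)
  have h4 : MulBit.qr41b (gen 4) = 0 := (qr41b_table.2 4).trans (by decide)
  have h5 : MulBit.qr41b (gen 5) = 0 := (qr41b_table.2 5).trans (by decide)
  have h6 : MulBit.qr41b (gen 6) = 1 := (qr41b_table.2 6).trans (by decide)
  have h7 : MulBit.qr41b (gen 7) = 1 := (qr41b_table.2 7).trans (by decide)
  rw [lin, Fin.sum_univ_eight]
  simp only [Fin.succ_zero_eq_one, Fin.succ_one_eq_two, hI, h0, h1, h2, h3, h4, h5, h6, h7,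
    show (2 : Fin 8).succ = 3 from rfl, show (3 : Fin 8).succ = 4 from rfl,
    show (4 : Fin 8).succ = 5 from rfl, show (5 : Fin 8).succ = 6 from rfl,
    show (6 : Fin 8).succ = 7 from rfl, show (7 : Fin 8).succ = 8 from rfl]
  ring

/-- The linear form of `qr73a` in coordinates. [folklore] -/
theorem lin_qr73a (c : Fin 9 → ZMod 2) : lin MulBit.qr73a c = c 1 + c 4 + c 5 + c 6 := by
  have hI : MulBit.qr73a gI = 0 := qr73a_table.1
  have h0 : MulBit.qr73a (gen 0) = 1 := (qr73a_table.2 0).trans (by decide)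
  have h1 : MulBit.qr73a (gen 1) = 0 := (qr73a_table.2 1).trans (by decide)
  have h2 : MulBit.qr73a (gen 2) = 0 := (qr73a_table.2 2).trans (by decide)
  have h3 : MulBit.qr73a (gen 3) = 1 := (qr73a_table.2 3).trans (by decide)
  have h4 : MulBit.qr73a (gen 4) = 1 := (qr73a_table.2 4).trans (by decide)
  have h5 : MulBit.qr73a (gen 5) = 1 := (qr73a_table.2 5).trans (by decide)
  have h6 : MulBit.qr73a (gen 6) = 0 := (qr73a_table.2 6).trans (by decide)
  have h7 : MulBit.qr73a (gen 7) = 0 := (qr73a_table.2 7).trans (by decide)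
  rw [lin, Fin.sum_univ_eight]
  simp only [Fin.succ_zero_eq_one, Fin.succ_one_eq_two, hI, h0, h1, h2, h3, h4, h5, h6, h7,
    show (2 : Fin 8).succ = 3 from rfl, show (3 : Fin 8).succ = 4 from rfl,
    show (4 : Fin 8).succ = 5 from rfl, show (5 : Fin 8).succ = 6 from rfl,
    show (6 : Fin 8).succ = 7 from rfl, show (7 : Fin 8).succ = 8 from rfl]
  ring

/-- The linear form of `qr73b` in coordinates. [folklore] -/
theorem lin_qr73b (c : Fin 9 → ZMod 2) : lin MulBit.qr73b c = c 1 + c 3 + c 5 + c 6 := by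
  have hI : MulBit.qr73b gI = 0 := qr73b_table.1
  have h0 : MulBit.qr73b (gen 0) = 1 := (qr73b_table.2 0).trans (by decide)
  have h1 : MulBit.qr73b (gen 1) = 0 := (qr73b_table.2 1).trans (by decide)
  have h2 : MulBit.qr73b (gen 2) = 1 := (qr73b_table.2 2).trans (by decide)
  have h3 : MulBit.qr73b (gen 3) = 0 := (qr73b_table.2 3).trans (by decide)
  have h4 : MulBit.qr73b (gen 4) = 1 := (qr73b_table.2 4).trans (by decide)
  have h5 : MulBit.qr73b (gen 5) = 1 := (qr73b_table.2 5).trans (by decide)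
  have h6 : MulBit.qr73b (gen 6) = 0 := (qr73b_table.2 6).trans (by decide)
  have h7 : MulBit.qr73b (gen 7) = 0 := (qr73b_table.2 7).trans (by decide)
  rw [lin, Fin.sum_univ_eight]
  simp only [Fin.succ_zero_eq_one, Fin.succ_one_eq_two, hI, h0, h1, h2, h3, h4, h5, h6, h7,
    show (2 : Fin 8).succ = 3 from rfl, show (3 : Fin 8).succ = 4 from rfl,
    show (4 : Fin 8).succ = 5 from rfl, show (5 : Fin 8).succ = 6 from rfl,
    show (6 : Fin 8).succ = 7 from rfl, show (7 : Fin 8).succ = 8 from rfl]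
  ring

/-- The linear form of `dyRe` in coordinates. [folklore] -/
theorem lin_dyRe (c : Fin 9 → ZMod 2) : lin MulBit.dyRe c = c 0 + c 3 + c 4 + c 7 + c 8 := by
  have hI : MulBit.dyRe gI = 1 := dyRe_table.1
  have h0 : MulBit.dyRe (gen 0) = 0 := (dyRe_table.2 0).trans (by decide)
  have h1 : MulBit.dyRe (gen 1) = 0 := (dyRe_table.2 1).trans (by decide)
  have h2 : MulBit.dyRe (gen 2) = 1 := (dyRe_table.2 2).trans (by decide)
  have h3 : MulBit.dyRe (gen 3) = 1 := (dyRe_table.2 3).trans (by decide)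
  have h4 : MulBit.dyRe (gen 4) = 0 := (dyRe_table.2 4).trans (by decide)
  have h5 : MulBit.dyRe (gen 5) = 0 := (dyRe_table.2 5).trans (by decide)
  have h6 : MulBit.dyRe (gen 6) = 1 := (dyRe_table.2 6).trans (by decide)
  have h7 : MulBit.dyRe (gen 7) = 1 := (dyRe_table.2 7).trans (by decide)
  rw [lin, Fin.sum_univ_eight]
  simp only [Fin.succ_zero_eq_one, Fin.succ_one_eq_two, hI, h0, h1, h2, h3, h4, h5, h6, h7,
    show (2 : Fin 8).succ = 3 from rfl, show (3 : Fin 8).succ = 4 from rfl,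
    show (4 : Fin 8).succ = 5 from rfl, show (5 : Fin 8).succ = 6 from rfl,
    show (6 : Fin 8).succ = 7 from rfl, show (7 : Fin 8).succ = 8 from rfl]
  ring

/-- The linear form of `dyNrm` in coordinates. [folklore] -/
theorem lin_dyNrm (c : Fin 9 → ZMod 2) : lin MulBit.dyNrm c = c 3 + c 4 := by
  have hI : MulBit.dyNrm gI = 0 := dyNrm_table.1
  have h0 : MulBit.dyNrm (gen 0) = 0 := (dyNrm_table.2 0).trans (by decide)
  have h1 : MulBit.dyNrm (gen 1) = 0 := (dyNrm_table.2 1).trans (by decide)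
  have h2 : MulBit.dyNrm (gen 2) = 1 := (dyNrm_table.2 2).trans (by decide)
  have h3 : MulBit.dyNrm (gen 3) = 1 := (dyNrm_table.2 3).trans (by decide)
  have h4 : MulBit.dyNrm (gen 4) = 0 := (dyNrm_table.2 4).trans (by decide)
  have h5 : MulBit.dyNrm (gen 5) = 0 := (dyNrm_table.2 5).trans (by decide)
  have h6 : MulBit.dyNrm (gen 6) = 0 := (dyNrm_table.2 6).trans (by decide)
  have h7 : MulBit.dyNrm (gen 7) = 0 := (dyNrm_table.2 7).trans (by decide)
  rw [lin, Fin.sum_univ_eight]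
  simp only [Fin.succ_zero_eq_one, Fin.succ_one_eq_two, hI, h0, h1, h2, h3, h4, h5, h6, h7,
    show (2 : Fin 8).succ = 3 from rfl, show (3 : Fin 8).succ = 4 from rfl,
    show (4 : Fin 8).succ = 5 from rfl, show (5 : Fin 8).succ = 6 from rfl,
    show (6 : Fin 8).succ = 7 from rfl, show (7 : Fin 8).succ = 8 from rfl]
  ring

/-- The linear form of `dyT` in coordinates. [folklore] -/
theorem lin_dyT (c : Fin 9 → ZMod 2) : lin MulBit.dyT c = c 2 + c 3 + c 7 + c 8 := by
  have hI : MulBit.dyT gI = 0 := dyT_table.1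
  have h0 : MulBit.dyT (gen 0) = 0 := (dyT_table.2 0).trans (by decide)
  have h1 : MulBit.dyT (gen 1) = 1 := (dyT_table.2 1).trans (by decide)
  have h2 : MulBit.dyT (gen 2) = 1 := (dyT_table.2 2).trans (by decide)
  have h3 : MulBit.dyT (gen 3) = 0 := (dyT_table.2 3).trans (by decide)
  have h4 : MulBit.dyT (gen 4) = 0 := (dyT_table.2 4).trans (by decide)
  have h5 : MulBit.dyT (gen 5) = 0 := (dyT_table.2 5).trans (by decide)
  have h6 : MulBit.dyT (gen 6) = 1 := (dyT_table.2 6).trans (by decide)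
  have h7 : MulBit.dyT (gen 7) = 1 := (dyT_table.2 7).trans (by decide)
  rw [lin, Fin.sum_univ_eight]
  simp only [Fin.succ_zero_eq_one, Fin.succ_one_eq_two, hI, h0, h1, h2, h3, h4, h5, h6, h7,
    show (2 : Fin 8).succ = 3 from rfl, show (3 : Fin 8).succ = 4 from rfl,
    show (4 : Fin 8).succ = 5 from rfl, show (5 : Fin 8).succ = 6 from rfl,
    show (6 : Fin 8).succ = 7 from rfl, show (7 : Fin 8).succ = 8 from rfl]
  ring

/-- Non-divisibility from norms: if `N(p) ∤ N(c)` then `p ∤ c`. [folklore] -/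
theorem not_dvd_of_not_norm_dvd {p c : ℤ[i]} (h : ¬ (Zsqrtd.norm p ∣ Zsqrtd.norm c)) : ¬ p ∣ c :=
  fun ⟨w, hw⟩ => h ⟨Zsqrtd.norm w, by rw [hw, Zsqrtd.norm_mul]⟩

/-- `genProd` as an explicit eightfold product. [folklore] -/
theorem genProd_eq (e : Fin 8 → ℕ) : genProd e = gen 0 ^ e 0 * gen 1 ^ e 1 * gen 2 ^ e 2 *
    gen 3 ^ e 3 * gen 4 ^ e 4 * gen 5 ^ e 5 * gen 6 ^ e 6 * gen 7 ^ e 7 := by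
  rw [genProd, Fin.prod_univ_eight]

/-- The exponent vector of `3 = gen 1`. [folklore] -/
def e3 : Fin 8 → ℕ := ![0, 1, 0, 0, 0, 0, 0, 0]

/-- The exponent vector of `5 = gen 2 · gen 3`. [folklore] -/
def e5 : Fin 8 → ℕ := ![0, 0, 1, 1, 0, 0, 0, 0]

/-- `genProd e3 = 3`, `genProd e5 = 5`. [folklore] -/
theorem genProd_e3_e5 : genProd e3 = 3 ∧ genProd e5 = 5 := by
  constructor <;> rw [genProd_eq] <;> decide

/-- Casting an exponent vector to coordinates. [folklore] -/
def coordVec (a : ℕ) (e : Fin 8 → ℕ) : Fin 9 → ZMod 2 := Fin.cases (a : ZMod 2) (fun k => (e k : ZMod 2))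

/-- `coord` of a decomposition, in terms of `coordVec`. [folklore] -/
theorem coord_decomposition' (a : ℕ) (e : Fin 8 → ℕ) {t : K1} (ht : t ≠ 0) :
    coord (toK1 (gI ^ a * genProd e) * t ^ 2) = coordVec a e :=
  coord_decomposition a e ht

/-- **The descent coordinates of the `2`-torsion points.** If `d = ∏ (gen j)^(eD j)` in `ℤ[i]`
(`d ≠ 0`), then `coordPair (-6d²) (2d) = ((1; e3), (1; eD))` and
`coordPair (-2d) (10d²) = ((1; eD), (1; e5))` (`-6 = i (1+i)² · 3`, `2 = i (i(1+i))²`,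
`-2 = i (1+i)²`, `10 = i (i(1+i))² · 5`). [folklore] -/
theorem coordPair_torsion {d : ℤ} (hd : d ≠ 0) (eD : Fin 8 → ℕ) (heD : (d : ℤ[i]) = genProd eD) :
    coordPair (-6 * (d : K1) ^ 2) (2 * d) = (coordVec 1 e3, coordVec 1 eD) ∧
    coordPair (-2 * (d : K1)) (10 * d ^ 2) = (coordVec 1 eD, coordVec 1 e5) := by
  have hdK : (d : K1) ≠ 0 := by exact_mod_cast hd
  have hdK' : (d : K1) = toK1 (d : ℤ[i]) := (toK1_intCast d).symm
  have hI : toK1 gI ≠ 0 := toK1_ne_zero (by decide)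
  have h2 : toK1 g2 ≠ 0 := toK1_ne_zero prime_g2.ne_zero
  have c6 : gI ^ 1 * genProd e3 * g2 ^ 2 = -6 := by rw [genProd_e3_e5.1]; decide
  have c2 : gI ^ 1 * (gI * g2) ^ 2 = 2 := by decide
  have cm2 : gI ^ 1 * g2 ^ 2 = -2 := by decide
  have c10 : gI ^ 1 * genProd e5 * (gI * g2) ^ 2 = 10 := by rw [genProd_e3_e5.2]; decide
  have E1 : (-6 * (d : K1) ^ 2) = toK1 (gI ^ 1 * genProd e3) * (toK1 g2 * d) ^ 2 := by
    have := congrArg toK1 c6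
    rw [_root_.map_mul, map_pow, map_neg, map_ofNat] at this
    linear_combination -((d : K1) ^ 2) * this
  have E2 : (2 * (d : K1)) = toK1 (gI ^ 1 * genProd eD) * (toK1 (gI * g2)) ^ 2 := by
    rw [← heD, _root_.map_mul, map_pow, toK1_intCast]
    have := congrArg toK1 c2
    rw [_root_.map_mul, map_pow, map_pow, map_ofNat] at this
    linear_combination -(d : K1) * this
  have E3 : (-2 * (d : K1)) = toK1 (gI ^ 1 * genProd eD) * (toK1 g2) ^ 2 := by
    rw [← heD, _root_.map_mul, map_pow, toK1_intCast]
    have := congrArg toK1 cm2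
    rw [_root_.map_mul, map_pow, map_pow, map_neg, map_ofNat] at this
    linear_combination -(d : K1) * this
  have E4 : (10 * (d : K1) ^ 2) = toK1 (gI ^ 1 * genProd e5) * (toK1 (gI * g2) * d) ^ 2 := by
    have := congrArg toK1 c10
    rw [_root_.map_mul, map_pow, map_ofNat] at this
    linear_combination -((d : K1) ^ 2) * this
  refine ⟨Prod.ext ?_ ?_, Prod.ext ?_ ?_⟩
  · show coord _ = _; rw [E1]; exact coord_decomposition' 1 e3 (mul_ne_zero h2 hdK)
  · show coord _ = _; rw [E2]; exact coord_decomposition' 1 eD (toK1_ne_zero (by decide))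
  · show coord _ = _; rw [E3]; exact coord_decomposition' 1 eD h2
  · show coord _ = _; rw [E4]
    exact coord_decomposition' 1 e5 (mul_ne_zero (toK1_ne_zero (by decide)) hdK)

/-! ### The rank bound -/

/-- **The complete `2`-descent over `K1`, rank bound** (Silverman AEC Prop. X.1.4 with the
counting `#E(K)/2E(K) = 2^r · #E(K)[2]`, tree `pow_finrank_add_two_le_natCard_range`, and the
Mordell–Weil theorem `module_finite_point_holds`). Let `d ≠ 0` with `2d, 3d, 5d ∣ D`, let `Rels`
be a property of pairs of coordinate vectors satisfied by `(coord x, coord (x + 2d))` for every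
`K1`-point `(x, y)` of `E^{(d)}` with `y ≠ 0`, and let `proj` be a homomorphism to `(ℤ/2)^r`
which vanishes on no non-zero solution of `Rels`. If the `proj`-images `p₁, p₂` of the descent
coordinates of the `2`-torsion points `(0, 0)`, `(-2d, 0)` satisfy `p₁ ≠ 0`, `p₂ ≠ 0`,
`p₁ + p₂ ≠ 0`, `p₁ ≠ p₂`, then `rank_ℤ E^{(d)}(K1) + 2 ≤ r`.
[cite: SilvermanAEC2009, Prop. X.1.4] -/
theorem mordellWeilRank_Wd_add_two_le {d : ℤ} (hd : d ≠ 0) (hd2 : (2 * (d : ℤ[i])) ∣ D)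
    (hd3 : (3 * (d : ℤ[i])) ∣ D) (hd5 : (5 * (d : ℤ[i])) ∣ D) {r : ℕ}
    (proj : ((Fin 9 → ZMod 2) × (Fin 9 → ZMod 2)) →+ (Fin r → ZMod 2))
    (Rels : (Fin 9 → ZMod 2) × (Fin 9 → ZMod 2) → Prop)
    (hgen : ∀ x y : K1, y ≠ 0 → y ^ 2 = x * (x + 2 * d) * (x - 3 * d) →
      Rels (coordPair x (x + 2 * d)))
    (hinj : ∀ v, Rels v → proj v = 0 → v = 0)
    (h₁ : proj (coordPair (-6 * (d : K1) ^ 2) (2 * d)) ≠ 0)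
    (h₂ : proj (coordPair (-2 * (d : K1)) (10 * d ^ 2)) ≠ 0)
    (h₃ : proj (coordPair (-6 * (d : K1) ^ 2) (2 * d)) +
      proj (coordPair (-2 * (d : K1)) (10 * d ^ 2)) ≠ 0)
    (h₁₂ : proj (coordPair (-6 * (d : K1) ^ 2) (2 * d)) ≠
      proj (coordPair (-2 * (d : K1)) (10 * d ^ 2))) :
    (Wd d).mordellWeilRank + 2 ≤ r := by
  haveI := Wd.isElliptic hd
  haveI : Module.Finite ℤ (Wd d).toAffine.Point :=
    WeierstrassCurve.module_finite_point_holds (W := Wd d)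
  have hsplit := Wd.splitTwoTorsion d
  set ψ : (Wd d).toAffine.Point →+ (Fin r → ZMod 2) := proj.comp (descentCoords d) with hψ
  -- torsion points
  have hT₁ : (Wd d).toAffine.Nonsingular 0 0 :=
    (Wd.nonsingular_iff hd 0 0).mpr (by ring)
  have hT₂ : (Wd d).toAffine.Nonsingular (-2 * (d : K1)) 0 :=
    (Wd.nonsingular_iff hd _ 0).mpr (by ring)
  set T₁ : (Wd d).toAffine.Point := .some 0 0 hT₁ with hT₁def
  set T₂ : (Wd d).toAffine.Point := .some (-2 * (d : K1)) 0 hT₂ with hT₂def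
  have hψT₁ : ψ T₁ = proj (coordPair (-6 * (d : K1) ^ 2) (2 * d)) := by
    rw [hψ, AddMonoidHom.comp_apply, hT₁def, descentCoords_T₁ hd]
  have hψT₂ : ψ T₂ = proj (coordPair (-2 * (d : K1)) (10 * d ^ 2)) := by
    rw [hψ, AddMonoidHom.comp_apply, hT₂def, descentCoords_T₂ hd]
  obtain ⟨a1, -, a3, -, -⟩ := Wd.a_eq d
  have hfin₁ : IsOfFinAddOrder T₁ := by
    refine isOfFinAddOrder_iff_nsmul_eq_zero.mpr ⟨2, two_pos, ?_⟩
    rw [two_nsmul, hT₁def]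
    exact add_self_of_Y_eq (by
      rw [negY, show (Wd d).toAffine.a₁ = (Wd d).a₁ from rfl,
        show (Wd d).toAffine.a₃ = (Wd d).a₃ from rfl, a1, a3]; ring)
  have hfin₂ : IsOfFinAddOrder T₂ := by
    refine isOfFinAddOrder_iff_nsmul_eq_zero.mpr ⟨2, two_pos, ?_⟩
    rw [two_nsmul, hT₂def]
    exact add_self_of_Y_eq (by
      rw [negY, show (Wd d).toAffine.a₁ = (Wd d).a₁ from rfl,
        show (Wd d).toAffine.a₃ = (Wd d).a₃ from rfl, a1, a3]; ring)
  -- kernel of `ψ` consists of doubles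
  have hker : ∀ P, ψ P = 0 → ∃ Q, P = 2 • Q := by
    intro P hP0
    suffices hδ : twoDescentMap hsplit P = 0 by
      have hmem : P ∈ (twoDescentMap hsplit).ker := hδ
      rw [ker_twoDescentMap hsplit] at hmem
      obtain ⟨Q, hQ⟩ := hmem
      exact ⟨Q, hQ.symm⟩
    rcases P with _ | ⟨x, y, hP⟩
    · rfl
    · have hEq : y ^ 2 = x * (x + 2 * d) * (x - 3 * d) := (Wd.nonsingular_iff hd x y).mp hP
      by_cases hy : y = 0
      · -- a `2`-torsion point: its `ψ`-value is non-zero, contradiction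
        exfalso
        have hroots : x = 0 ∨ x = -2 * (d : K1) ∨ x = 3 * (d : K1) := by
          rw [hy, zero_pow two_ne_zero, zero_eq_mul, mul_eq_zero] at hEq
          rcases hEq with (h0 | h0) | h0
          · exact Or.inl h0
          · exact Or.inr (Or.inl (by linear_combination h0))
          · exact Or.inr (Or.inr (by linear_combination h0))
        rcases hroots with rfl | rfl | rfl
        · have : Point.some 0 y hP = T₁ := by rw [hT₁def]; congr
          rw [this, hψT₁] at hP0; exact h₁ hP0
        · have : Point.some (-2 * (d : K1)) y hP = T₂ := by rw [hT₂def]; congr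
          rw [this, hψT₂] at hP0; exact h₂ hP0
        · -- `T₃ = T₁ + T₂`
          have hsum : Point.some (3 * (d : K1)) y hP = T₁ + T₂ := by
            rw [hT₁def, hT₂def, add_of_X_ne (by
              intro h0; apply (show (d : K1) ≠ 0 by exact_mod_cast hd)
              linear_combination (1/2 : K1) * h0)]
            have hd0 : (d : K1) ≠ 0 := by exact_mod_cast hd
            have hslope : (Wd d).toAffine.slope 0 (-2 * (d : K1)) 0 0 = 0 := by
              rw [slope_of_X_ne (by intro h0; apply hd0; linear_combination (1/2 : K1) * h0)]
              simp
            obtain ⟨_, a2, _, _, _⟩ := Wd.a_eq d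
            congr 1
            · rw [addX, hslope, show (Wd d).toAffine.a₁ = (Wd d).a₁ from rfl,
                show (Wd d).toAffine.a₂ = (Wd d).a₂ from rfl, a1, a2]; ring
            · rw [addY, negAddY, hslope, negY, show (Wd d).toAffine.a₁ = (Wd d).a₁ from rfl,
                show (Wd d).toAffine.a₃ = (Wd d).a₃ from rfl, a1, a3, hy]
              ring
          rw [hsum, map_add, hψT₁, hψT₂] at hP0
          exact h₃ hP0
      · -- generic point: relations + injectivity force all coordinates to vanish
        obtain ⟨hx0, hx2, -⟩ := Wd.ne_roots_of_ne_zero hEq hy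
        have hx2' : x + 2 * d ≠ 0 := fun h0 => hx2 (by linear_combination h0)
        have hval : descentCoords d (Point.some x y hP) = coordPair x (x + 2 * d) :=
          descentCoords_some hP hEq hy
        have hrel := hgen x y hy hEq
        have hzero := hinj _ hrel (by rw [← hval]; exact hP0)
        obtain ⟨⟨a₁', e₁, t₁, ht₁, ha₁, he₁, hb₁⟩, ⟨a₂', e₂, t₂, ht₂, ha₂, he₂, hb₂⟩⟩ :=
          exists_decompositions hd2 hd3 hd5 hEq hy
        have hc₁ : coord x = 0 := congrArg Prod.fst hzero
        have hc₂ : coord (x + 2 * d) = 0 := congrArg Prod.snd hzero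
        rw [hb₁, coord_decomposition a₁' e₁ ht₁] at hc₁
        rw [hb₂, coord_decomposition a₂' e₂ ht₂] at hc₂
        -- all exponents are even, hence `0`
        have hsq : ∀ (a : ℕ) (e : Fin 8 → ℕ) (t : K1), a < 2 → (∀ j, e j < 2) →
            (Fin.cases (a : ZMod 2) (fun k => (e k : ZMod 2)) : Fin 9 → ZMod 2) = 0 →
            toK1 (gI ^ a * genProd e) * t ^ 2 = t ^ 2 := by
          intro a e t ha he h0
          have ha0 : a = 0 := by
            have := congrFun h0 0
            simp only [Fin.cases_zero, Pi.zero_apply] at this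
            rw [ZMod.natCast_eq_zero_iff_even] at this
            obtain ⟨k, hk⟩ := this; omega
          have he0 : e = 0 := by
            funext j
            have := congrFun h0 j.succ
            simp only [Fin.cases_succ, Pi.zero_apply] at this
            rw [ZMod.natCast_eq_zero_iff_even] at this
            have := he j
            obtain ⟨k, hk⟩ := ‹Even (e j)›
            simp only [Pi.zero_apply]; omega
          rw [ha0, he0, pow_zero, genProd_zero, mul_one, map_one, one_mul]
        have hxsq : x = t₁ ^ 2 := by rw [hb₁]; exact hsq a₁' e₁ t₁ ha₁ he₁ hc₁
        have hx2sq : x + 2 * d = t₂ ^ 2 := by rw [hb₂]; exact hsq a₂' e₂ t₂ ha₂ he₂ hc₂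
        rw [twoDescentMap_apply, twoDescentComponent_some_of_ne hP hx0,
          twoDescentComponent_some_of_ne hP hx2, sub_zero,
          show x - -2 * (d : K1) = x + 2 * d by ring, hx2sq, hxsq, sqClass_sq, sqClass_sq]
        rfl
  have hne₁ : ψ T₁ ≠ 0 := by rw [hψT₁]; exact h₁
  have hne₂ : ψ T₂ ≠ 0 := by rw [hψT₂]; exact h₂
  have hne₃ : ψ (T₁ + T₂) ≠ 0 := by rw [map_add, hψT₁, hψT₂]; exact h₃
  have hne₁₂ : ψ T₁ ≠ ψ T₂ := by rw [hψT₁, hψT₂]; exact h₁₂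
  have hbound := pow_finrank_add_two_le_natCard_range ψ hker hfin₁ hfin₂ hne₁ hne₂ hne₃ hne₁₂
  have hcard : Nat.card ψ.range ≤ 2 ^ r := by
    calc Nat.card ψ.range ≤ Nat.card (Fin r → ZMod 2) :=
          Nat.card_le_card_of_injective _ Subtype.val_injective
      _ = 2 ^ r := by rw [Nat.card_eq_fintype_card, Fintype.card_fun, ZMod.card, Fintype.card_fin]
  have hle := (Nat.pow_le_pow_iff_right (by norm_num)).mp (hbound.trans hcard)
  unfold WeierstrassCurve.mordellWeilRank
  exact hle

end Literature.Barriers.BirchSwinnertonDyer.DokchitserDokchitser2011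

end
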